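import Summits.ResolutionOfSingularities.ResolutionOfSingularities.Theorems.DescentDescentPerfectToAllCountableReduction
import Summits.ResolutionOfSingularities.ResolutionOfSingularities.Theorems.DescentDescentPerfectToAllFinitePBasis
import Mathlib.Algebra.Algebra.ZMod

/-!
# `DescentPerfectToAll` (stmt-ResolutionOfSingularities-0549): one master class of resolvable ground
# fields, and the residual of the crux stated as its complement

Route `ResolutionOfSingularities/Descent`, crux `DescentPerfectToAll` (resolution over perfect fields of
characteristic `p` ⇒ resolution over all fields of characteristic `p`). Helper (OURS; not a statement of
any manuscript; `--supports` the crux, does not close it).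

The tree proves the crux's conclusion (given its antecedent `PerfectRes p`) over several classes of ground
fields `k`: essentially of finite type over a perfect field (`hasResolution_of_perfectRes_of_essFiniteType`),
separably exhausted by finitely generated subfields (`hasResolution_of_perfectRes_of_separablyExhausted`),
separable algebraic over a finitely generated subfield / over a subfield essentially of finite type over a
perfect field (`…_of_isSeparable_fg`, `…_of_isSeparable_essFiniteType`), transcendence degree `≤ 1`,
finite `p`-basis (`…_of_pIndependent`). This file records the ONE class containing them all and proved by
the same mechanism, and restates the crux as a statement about its complement:

* `hasResolution_of_perfectRes_of_exhaustedByEssFiniteType` — **MASTER CLASS.** Say `k` is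
  *EFT-separably exhausted* if every finite subset of `k` lies in a subfield `E ≤ k` which is essentially
  of finite type over some perfect field and over which `k` is separable in Mac Lane's sense
  (`E`-linearly independent finite families have `E`-independent `p`-th powers). Then `PerfectRes p`
  gives a resolution of every reduced separated `k`-scheme of finite type: descend `X` to a finitely
  generated `K₀ = closure s` (`stub_fgModel`), pick `E ⊇ s`, resolve `X₀ ×_{K₀} E` by the
  essentially-finite-type case, ascend along `k/E` (`hasResolution_pullback_subtype_of_linearIndepOn_pow`).
* `essFiniteType_zmod_of_eq_closure` — a finitely generated subfield is essentially of finite type over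
  `ZMod p`.
* `exhaustedByEssFiniteType_of_isSeparable`, `…_of_separablyExhausted`, `…_of_pIndependent` — the landed
  classes are sub-classes, so the master theorem re-derives them (the essentially-finite-type case itself
  is the degenerate sub-case `E = k`, not re-derived here).
* `descentPerfectToAll_iff_residual` — **THE RESIDUAL.** The crux (binder form, verbatim) is EQUIVALENT
  to: for every prime `p`, `PerfectRes p` implies resolution over every COUNTABLE field of characteristic
  `p` that is NOT EFT-separably exhausted (countability by `descentPerfectToAll_iff_countable`). Informal
  example of such a field: a countable subfield `K ⊂ 𝔽_p((t))` containing `𝔽_p(t, u)`, `u` a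
  transcendental power series, with `K = K^p(t)` (`p`-rank `1`, transcendence degree `≥ 2`; every perfect
  subfield of `𝔽_p((t))` is `𝔽_p`, and a finitely generated `E ∋ t, u` has `p`-rank `≥ 2`, so `K/E` is
  never separable).
-/

noncomputable section

set_option linter.dupNamespace false -- mandated namespace of this single-conjunct summit

open CategoryTheory CategoryTheory.Limits AlgebraicGeometry
open Literature.AlgebraicGeometry.Resolution

namespace Summit.ResolutionOfSingularities.ResolutionOfSingularities.Theorems

/-- **Master class: resolution over perfect fields ⇒ resolution over every EFT-separably exhausted
field.** If every finite subset `s ⊆ k` lies in a subfield `E` essentially of finite type over a perfect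
field `k₀` such that `k/E` satisfies Mac Lane's criterion, then every reduced separated `k`-scheme of
finite type has a resolution (given resolution over perfect fields of characteristic `p`): field of
definition `K₀ = closure s ≤ E`, resolution of the level `X₀ ×_{K₀} E`
(`hasResolution_of_perfectRes_of_essFiniteType`), separable ascent to `X₀ ×_{K₀} k ≅ X`.
[cite: EGAIV2, Prop. 6.7.4] -/
theorem hasResolution_of_perfectRes_of_exhaustedByEssFiniteType (p : ℕ) [Fact p.Prime]
    (H : ∀ (κ : Type) [Field κ] [CharP κ p] [PerfectField κ] (Z : Scheme.{0}) (h : Z ⟶ Spec (.of κ)),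
      IsSeparated h → LocallyOfFiniteType h → QuasiCompact h → IsReduced Z → Scheme.HasResolution Z)
    (k : Type) [Field k] [CharP k p]
    (hk : ∀ s : Finset k, ∃ (k₀ : Type) (_ : Field k₀) (_ : PerfectField k₀) (E : Subfield k)
      (_ : Algebra k₀ E), Algebra.EssFiniteType k₀ E ∧ (↑s : Set k) ⊆ E ∧
        ∀ u : Finset k, LinearIndepOn E _root_.id (↑u : Set k) →
          LinearIndepOn E (fun x : k => x ^ p) (↑u : Set k))
    (X : Scheme.{0}) (f : X ⟶ Spec (.of k)) [IsSeparated f] [LocallyOfFiniteType f] [QuasiCompact f]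
    [IsReduced X] : Scheme.HasResolution X := by
  classical
  -- finitely generated field of definition (`stub_fgModel`)
  obtain ⟨K₀, s, hK₀, X₀, f₀, h₁, h₂, h₃, h₄, ⟨e⟩⟩ := stub_fgModel k X f ‹_› ‹_› ‹_› ‹_›
  haveI := h₁; haveI := h₂; haveI := h₃; haveI := h₄
  haveI : IsReduced (pullback f₀ (Spec.map (CommRingCat.ofHom K₀.subtype))) :=
    isReduced_of_isOpenImmersion e.inv
  -- an essentially-finite-type-over-perfect level `E ⊇ K₀` over which `k` is separable
  obtain ⟨k₀, _, _, E, _, hE, hsE, hML⟩ := hk s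
  have hK₀E : K₀ ≤ E := by
    rw [hK₀, Subfield.closure_le]
    exact hsE
  haveI : CharP E p := E.subtype.charP Subtype.val_injective p
  -- resolve the level
  set ι₁ := Spec.map (CommRingCat.ofHom (Subfield.inclusion hK₀E)) with hι₁
  haveI : IsReduced (pullback f₀ ι₁) := isReduced_pullback_inclusion K₀ E hK₀E f₀
  have hresE : Scheme.HasResolution (pullback f₀ ι₁) :=
    hasResolution_of_perfectRes_of_essFiniteType p H k₀ E hE _ (pullback.snd f₀ ι₁)
      inferInstance inferInstance inferInstance inferInstance
  -- ascend along the separable extension `k/E`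
  haveI : ExpChar k p := ExpChar.prime (Fact.out : p.Prime)
  have hk' := hasResolution_pullback_subtype_of_linearIndepOn_pow p Fact.out E hML
    (pullback.snd f₀ ι₁) hresE
  -- transport along `(X₀ ×_{K₀} E) ×_E k ≅ X₀ ×_{K₀} k ≅ X`
  have hcomp : E.subtype.comp (Subfield.inclusion hK₀E) = K₀.subtype := RingHom.ext fun _ => rfl
  have ecomp : Spec.map (CommRingCat.ofHom E.subtype) ≫ ι₁ =
      Spec.map (CommRingCat.ofHom K₀.subtype) := by
    rw [hι₁, ← Spec.map_comp, ← CommRingCat.ofHom_comp, hcomp]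
  exact (hk'.of_iso (pullbackLeftPullbackSndIso f₀ ι₁ (Spec.map (CommRingCat.ofHom E.subtype)) ≪≫
    pullback.congrHom rfl ecomp).hom).of_iso e.inv

/-! ## The landed classes are sub-classes -/

/-- A finitely generated subfield `L = closure t` of a field of characteristic `p` is essentially of
finite type over `ZMod p` (for any — the unique — `ZMod p`-algebra structure): `L` is generated over the
prime field by the finite set `t`. [folklore] -/
theorem essFiniteType_zmod_of_eq_closure {p : ℕ} [Fact p.Prime] {k : Type} [Field k] [CharP k p]
    (L : Subfield k) (t : Finset k) (hL : L = Subfield.closure (↑t : Set k)) [Algebra (ZMod p) L] :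
    Algebra.EssFiniteType (ZMod p) L := by
  classical
  have htL : ∀ x ∈ t, x ∈ L := fun x hx => by
    rw [hL]
    exact Subfield.subset_closure hx
  refine IntermediateField.fg_top_iff.mp ⟨t.subtype (· ∈ L), ?_⟩
  set G := IntermediateField.adjoin (ZMod p) (↑(t.subtype (· ∈ L)) : Set L) with hG
  rw [eq_top_iff]
  intro z _
  -- the image of `G` in `k` is a subfield containing `t`, hence `closure t = L`
  have hle : Subfield.closure (↑t : Set k) ≤ G.toSubfield.map L.subtype := by
    rw [Subfield.closure_le]
    intro x hx
    refine ⟨⟨x, htL x hx⟩, ?_, rfl⟩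
    change (⟨x, htL x hx⟩ : L) ∈ G
    refine IntermediateField.subset_adjoin (ZMod p) _ ?_
    rw [Finset.mem_coe, Finset.mem_subtype]
    exact hx
  have hz : (z : k) ∈ Subfield.closure (↑t : Set k) := hL.le z.2
  obtain ⟨w, hw, hwz⟩ := hle hz
  have hwz' : w = z := Subtype.ext hwz
  rw [← hwz']
  exact hw

/-- **Separable algebraic over essentially-finite-type over perfect ⇒ EFT-separably exhausted**: if
`K ≤ k` is essentially of finite type over the perfect field `k₀` and `k/K` is separable algebraic,
every finite `s ⊆ k` lies in `E = K(s)`, which is again essentially of finite type over `k₀`, and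
`k/E` is separable algebraic, hence Mac Lane-separable. [folklore] -/
theorem exhaustedByEssFiniteType_of_isSeparable {p : ℕ} [Fact p.Prime] {k : Type} [Field k]
    [CharP k p] (k₀ : Type) [Field k₀] [PerfectField k₀] (K : Subfield k) [Algebra k₀ K]
    (hK : Algebra.EssFiniteType k₀ K) [Algebra.IsSeparable K k] (s : Finset k) :
    ∃ (k₀ : Type) (_ : Field k₀) (_ : PerfectField k₀) (E : Subfield k) (_ : Algebra k₀ E),
      Algebra.EssFiniteType k₀ E ∧ (↑s : Set k) ⊆ E ∧
        ∀ u : Finset k, LinearIndepOn E _root_.id (↑u : Set k) →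
          LinearIndepOn E (fun x : k => x ^ p) (↑u : Set k) := by
  classical
  set E : Subfield k := (IntermediateField.adjoin K (↑s : Set k)).toSubfield with hEdef
  have hKE : K ≤ E := fun x hx =>
    (IntermediateField.adjoin K (↑s : Set k)).algebraMap_mem ⟨x, hx⟩
  letI : Algebra K E := (Subfield.inclusion hKE).toAlgebra
  haveI : IsScalarTower K E k := IsScalarTower.of_algebraMap_eq fun _ => rfl
  haveI : Algebra.EssFiniteType K E := essFiniteType_of_eq_adjoin_toSubfield K E s hEdef
  letI : Algebra k₀ E := ((algebraMap K E).comp (algebraMap k₀ K)).toAlgebra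
  haveI : IsScalarTower k₀ K E := IsScalarTower.of_algebraMap_eq fun _ => rfl
  haveI : Algebra.EssFiniteType k₀ K := hK
  have hE : Algebra.EssFiniteType k₀ E := Algebra.EssFiniteType.comp k₀ K E
  haveI : Algebra.IsSeparable E k := Algebra.isSeparable_tower_top_of_isSeparable K E k
  exact ⟨k₀, inferInstance, inferInstance, E, inferInstance, hE,
    fun x hx => IntermediateField.subset_adjoin K _ hx,
    fun u hu => linearIndepOn_pow_of_isSeparable E u hu⟩

/-- **Separably exhausted by finitely generated subfields ⇒ EFT-separably exhausted**: a finitely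
generated level `L = closure t` is essentially of finite type over the perfect field `ZMod p`.
[folklore] -/
theorem exhaustedByEssFiniteType_of_separablyExhausted {p : ℕ} [Fact p.Prime] {k : Type} [Field k]
    [CharP k p]
    (hk : ∀ s : Finset k, ∃ (L : Subfield k) (t : Finset k), L = Subfield.closure (↑t : Set k) ∧
      (↑s : Set k) ⊆ L ∧ ∀ u : Finset k, LinearIndepOn L _root_.id (↑u : Set k) →
        LinearIndepOn L (fun x : k => x ^ p) (↑u : Set k))
    (s : Finset k) :
    ∃ (k₀ : Type) (_ : Field k₀) (_ : PerfectField k₀) (E : Subfield k) (_ : Algebra k₀ E),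
      Algebra.EssFiniteType k₀ E ∧ (↑s : Set k) ⊆ E ∧
        ∀ u : Finset k, LinearIndepOn E _root_.id (↑u : Set k) →
          LinearIndepOn E (fun x : k => x ^ p) (↑u : Set k) := by
  obtain ⟨L, t, hL, hsL, hML⟩ := hk s
  haveI : CharP L p := L.subtype.charP Subtype.val_injective p
  letI : Algebra (ZMod p) L := ZMod.algebra L p
  haveI : PerfectField (ZMod p) := PerfectField.ofFinite
  exact ⟨ZMod p, inferInstance, inferInstance, L, inferInstance,
    essFiniteType_zmod_of_eq_closure L t hL, hsL, hML⟩

/-- **Finite `p`-basis ⇒ EFT-separably exhausted**: if `t : ι → k` is finite and `p`-independent and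
`k` is algebraic over `closure (range t)`, then `k` is separable algebraic over this finitely generated
subfield (`isSeparable_closure_range_of_isAlgebraic`), which is essentially of finite type over `ZMod p`.
[folklore] -/
theorem exhaustedByEssFiniteType_of_pIndependent {p : ℕ} [Fact p.Prime] {k : Type} [Field k]
    [CharP k p] {ι : Type} [Fintype ι] [DecidableEq ι] (t : ι → k)
    (ht : ∀ e : (ι → Fin p) → k, ∑ α, (∏ i, t i ^ (α i : ℕ)) * e α ^ p = 0 → ∀ α, e α = 0)
    [Algebra.IsAlgebraic (Subfield.closure (Set.range t)) k] (s : Finset k) :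
    ∃ (k₀ : Type) (_ : Field k₀) (_ : PerfectField k₀) (E : Subfield k) (_ : Algebra k₀ E),
      Algebra.EssFiniteType k₀ E ∧ (↑s : Set k) ⊆ E ∧
        ∀ u : Finset k, LinearIndepOn E _root_.id (↑u : Set k) →
          LinearIndepOn E (fun x : k => x ^ p) (↑u : Set k) := by
  classical
  haveI := isSeparable_closure_range_of_isAlgebraic p t ht
  haveI : CharP (Subfield.closure (Set.range t)) p :=
    (Subfield.closure (Set.range t)).subtype.charP Subtype.val_injective p
  letI : Algebra (ZMod p) (Subfield.closure (Set.range t)) := ZMod.algebra _ p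
  haveI : PerfectField (ZMod p) := PerfectField.ofFinite
  have hK : Algebra.EssFiniteType (ZMod p) (Subfield.closure (Set.range t)) :=
    essFiniteType_zmod_of_eq_closure _ (Finset.univ.image t)
      (by rw [Finset.coe_image, Finset.coe_univ, Set.image_univ])
  exact exhaustedByEssFiniteType_of_isSeparable (ZMod p) (Subfield.closure (Set.range t)) hK s

/-! ## The crux restated on the residual class -/

/-- **Where the crux `DescentPerfectToAll` lives.** The crux (left-hand side, verbatim binder form of
stmt-0549) is EQUIVALENT to its restriction to COUNTABLE ground fields that are NOT EFT-separably
exhausted — i.e. countable `k` of characteristic `p` having a finite subset contained in no subfield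
`E`, essentially of finite type over a perfect field, with `k/E` Mac Lane-separable. (`→` is
specialisation; `←` combines `descentPerfectToAll_iff_countable` with the master class
`hasResolution_of_perfectRes_of_exhaustedByEssFiniteType`.) [folklore] -/
theorem descentPerfectToAll_iff_residual :
    (∀ p : ℕ, p.Prime → (∀ (κ : Type) [Field κ] [CharP κ p] [PerfectField κ] (Z : Scheme.{0})
      (g : Z ⟶ Spec (.of κ)), IsSeparated g → LocallyOfFiniteType g → QuasiCompact g →
        IsReduced Z → Scheme.HasResolution Z) →
      ∀ (k : Type) [Field k] [CharP k p] (X : Scheme.{0}) (f : X ⟶ Spec (.of k)),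
        IsSeparated f → LocallyOfFiniteType f → QuasiCompact f → IsReduced X →
          Scheme.HasResolution X) ↔
    (∀ p : ℕ, p.Prime → (∀ (κ : Type) [Field κ] [CharP κ p] [PerfectField κ] (Z : Scheme.{0})
      (g : Z ⟶ Spec (.of κ)), IsSeparated g → LocallyOfFiniteType g → QuasiCompact g →
        IsReduced Z → Scheme.HasResolution Z) →
      ∀ (k : Type) [Field k] [CharP k p], Countable k →
        (¬ ∀ s : Finset k, ∃ (k₀ : Type) (_ : Field k₀) (_ : PerfectField k₀) (E : Subfield k)
          (_ : Algebra k₀ E), Algebra.EssFiniteType k₀ E ∧ (↑s : Set k) ⊆ E ∧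
            ∀ u : Finset k, LinearIndepOn E _root_.id (↑u : Set k) →
              LinearIndepOn E (fun x : k => x ^ p) (↑u : Set k)) →
        ∀ (X : Scheme.{0}) (f : X ⟶ Spec (.of k)), IsSeparated f → LocallyOfFiniteType f →
          QuasiCompact f → IsReduced X → Scheme.HasResolution X) := by
  constructor
  · intro h p hp H k _ _ _ _ X f a b c d
    exact h p hp H k X f a b c d
  · intro h
    refine descentPerfectToAll_iff_countable.mpr fun p hp H k _ _ hk X f a b c d => ?_
    haveI : Fact p.Prime := ⟨hp⟩
    refine (em _).elim (fun hC => ?_) fun hC => h p hp H k hk hC X f a b c d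
    haveI := a; haveI := b; haveI := c; haveI := d
    exact hasResolution_of_perfectRes_of_exhaustedByEssFiniteType p
      (fun κ _ _ _ Z g a b c d => H κ Z g a b c d) k hC X f

end Summit.ResolutionOfSingularities.ResolutionOfSingularities.Theorems

end
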